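import Summits.QuantumAdvantage.QuantumAdvantage.Theses.LinnikCubicClassGroups
import Literature.NumberTheory.CubicFields.PureCubicLatticeSpecs
import Literature.Computability.Cryptography.PureCubicLatticeFP

/-!
# Crux `LinnikCubicClassGroups.PureCubicClassGroupFBQP` (stmt-QuantumAdvantage-11544) — stub `stub_cubicLatticeFP`

Line `arakelov-giant-step-cycle`, stub `stub_cubicLatticeFP` (S3b-G1): **the code-level arithmetic of a
pure cubic field** `K = ℚ(θ)`, `θ³ = ab²`, in coordinates w.r.t. Dedekind's basis `(1, θ, θ₂ = θ²/b)` —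
five typed polynomial-time programs (`CodeFP`) with algebraic specifications: product of element codes,
norm of an element code as a fraction, lattice × non-zero element, lattice × lattice (`ℤ`-span of the
products), lattice + one generator, all lattice outputs canonical (Hermite normal form, reduced
entries, `gcd(den, entries) = 1`), and uniqueness of canonical codes. Assembly of the tree's bricks:

* programs and codes: `Literature/NumberTheory/CubicFields/PureCubicLatticeCodes.lean` (`mulE`, `normE`,
  `latScale`, `latProd`, `latAddGen`; the member set `Mem`, canonicity `Canon`, value `val` are
  literally the clauses of this statement);
* `CodeFP` realisations: `Literature/Computability/Cryptography/PureCubicLatticeFP.lean`;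
* three-column HNF algebra and uniqueness: `PureCubicLatticeHNF.lean`, `PureCubicLatticeHNFCanon.lean`;
* semantics and the five specifications: `PureCubicLatticeSemantics.lean`, `PureCubicLatticeSpecs.lean`
  (the norm form of `stub_pureCubicOrder` enters only through `N(e) ≠ 0` for `val e ≠ 0`, the
  `ℚ`-independence of `(1, θ, θ₂)` only through uniqueness).
-/

-- the problem namespace repeats the summit name (`QuantumAdvantage.QuantumAdvantage`)
set_option linter.dupNamespace false

namespace Summit.QuantumAdvantage.QuantumAdvantage.Theorems.LinnikCubicClassGroups

open Literature.Computability.Complexity (boolPair CodeFP FP)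
open Literature.Computability.Complexity.CodeFP (pairE strE natE intE bitE unE rawE)
open scoped NumberField
open Literature.NumberTheory.CubicFields.PureCubicCodes
open Literature.Computability.Cryptography.PureCubicFP

/-- **S3b-G1 core (`stub_cubicLatticeFPCore`)**: the content of `stub_cubicLatticeFP` over the tree's vocabulary
(`PureCubicCodes.mulE/normE/latScale/latProd/latAddGen`, member sets `Mem`, canonicity `Canon`, values `val`), under the
weaker hypotheses actually used (`b ≠ 0` in `K`, `θ³ = ab²`, `ℚ`-independence of `(1, θ, θ₂)`, the norm form): the five
programs are typed polynomial time and meet their algebraic specifications. Registered as an auxiliary stub handle because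
the verbatim signature of `stub_cubicLatticeFP` (below, proved from this) exceeds the gate's stub-signature length cap. -/
theorem stub_cubicLatticeFPCore :
    (CodeFP (pairE (pairE natE natE) (pairE (pairE intE (pairE intE (pairE intE natE))) (pairE intE (pairE intE (pairE intE natE)))))
        (pairE intE (pairE intE (pairE intE natE))) mulE ∧
      CodeFP (pairE (pairE natE natE) (pairE intE (pairE intE (pairE intE natE)))) (pairE intE natE) normE ∧
      CodeFP (pairE (pairE natE natE) (pairE (pairE natE (rawE intE)) (pairE intE (pairE intE (pairE intE natE)))))
        (pairE natE (rawE intE)) latScale ∧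
      CodeFP (pairE (pairE natE natE) (pairE (pairE natE (rawE intE)) (pairE natE (rawE intE)))) (pairE natE (rawE intE)) latProd ∧
      CodeFP (pairE (pairE natE natE) (pairE (pairE natE (rawE intE)) (pairE intE (pairE intE (pairE intE natE)))))
        (pairE natE (rawE intE)) latAddGen) ∧
    ∀ (a b : ℕ) (K : Type) [Field K] [NumberField K] (θ : K), (b : K) ≠ 0 → θ ^ 3 = ((a * b ^ 2 : ℕ) : K) →
      (∀ c₀ c₁ c₂ : ℚ, (c₀ : K) + (c₁ : K) * θ + (c₂ : K) * (θ ^ 2 / (b : K)) = 0 → c₀ = 0 ∧ c₁ = 0 ∧ c₂ = 0) →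
      (∀ x y z : ℚ, Algebra.norm ℚ ((x : K) + (y : K) * θ + (z : K) * (θ ^ 2 / (b : K))) =
        x ^ 3 + (a * b ^ 2 : ℕ) * y ^ 3 + (a ^ 2 * b : ℕ) * z ^ 3 - 3 * (a * b : ℕ) * x * y * z) →
      (∀ e₁ e₂ : ℤ × ℤ × ℤ × ℕ, 1 ≤ e₁.2.2.2 → 1 ≤ e₂.2.2.2 →
        1 ≤ (mulE ((a, b), (e₁, e₂))).2.2.2 ∧ val θ b (mulE ((a, b), (e₁, e₂))) = val θ b e₁ * val θ b e₂) ∧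
      (∀ e : ℤ × ℤ × ℤ × ℕ, 1 ≤ e.2.2.2 → 1 ≤ (normE ((a, b), e)).2 ∧
        (((normE ((a, b), e)).1 : ℤ) : ℚ) / (((normE ((a, b), e)).2 : ℕ) : ℚ) = Algebra.norm ℚ (val θ b e)) ∧
      (∀ c c' : ℕ × List ℤ, Canon c → Canon c' → (∀ φ : K, Mem θ b c φ ↔ Mem θ b c' φ) → c = c') ∧
      (∀ (c : ℕ × List ℤ) (e : ℤ × ℤ × ℤ × ℕ), Canon c → 1 ≤ e.2.2.2 → val θ b e ≠ 0 →
        Canon (latScale ((a, b), (c, e))) ∧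
        ∀ φ : K, Mem θ b (latScale ((a, b), (c, e))) φ ↔ ∃ ψ : K, Mem θ b c ψ ∧ φ = ψ * val θ b e) ∧
      (∀ c₁ c₂ : ℕ × List ℤ, Canon c₁ → Canon c₂ →
        Canon (latProd ((a, b), (c₁, c₂))) ∧
        ∀ φ : K, Mem θ b (latProd ((a, b), (c₁, c₂))) φ ↔
          φ ∈ AddSubgroup.closure {ψ : K | ∃ ψ₁ ψ₂ : K, Mem θ b c₁ ψ₁ ∧ Mem θ b c₂ ψ₂ ∧ ψ = ψ₁ * ψ₂}) ∧
      (∀ (c : ℕ × List ℤ) (e : ℤ × ℤ × ℤ × ℕ), Canon c → 1 ≤ e.2.2.2 →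
        Canon (latAddGen ((a, b), (c, e))) ∧
        ∀ φ : K, Mem θ b (latAddGen ((a, b), (c, e))) φ ↔
          ∃ (ψ : K) (k : ℤ), Mem θ b c ψ ∧ φ = ψ + (k : K) * val θ b e) := by
  refine ⟨⟨mulEC, normEC, latScaleC, latProdC, latAddGenC⟩, ?_⟩
  intro a b K _ _ θ hbK hθ hind hnorm
  exact ⟨mulE_spec θ hbK hθ, normE_spec θ hnorm, canon_unique θ b hind, latScale_spec θ hbK hθ hnorm,
    latProd_spec θ hbK hθ, latAddGen_spec θ a b⟩

/-- **S3b-G1 `stub_cubicLatticeFP`** (size L; `CodeFP` programming + HNF algebra; reshaped in by lead c1). The code-level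
arithmetic of the pure cubic field `K = ℚ(θ)`, `θ³ = ab²`, in coordinates w.r.t. `(1, θ, θ₂ = θ²/b)`: ELEMENT codes
`e = (x, y, z, den) : ℤ × ℤ × ℤ × ℕ` with value `(x + yθ + zθ₂)/den`, LATTICE codes `c = (den, [h11,h12,h13,h22,h23,h33]) : ℕ × List ℤ`
meaning `(1/den) · ℤ-rowspan [[h11,h12,h13],[0,h22,h23],[0,0,h33]]`, CANONICAL when in Hermite normal form with reduced entries
and `gcd(den, entries) = 1` (then unique for its lattice). Five polynomial-time programs with algebraic specifications (given the
facts of `stub_pureCubicOrder`: independence of `(1,θ,θ₂)`, norm form): product of elements (`θ² = bθ₂`, `θ₂² = aθ`, `θθ₂ = ab`),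
norm of an element as a fraction, lattice × nonzero element, lattice × lattice (`ℤ`-span of products, HNF of nine generators),
lattice + one generator; all outputs canonical. This is the shared bottom layer of the cubic infrastructure (S3b) and of the
class-group core (S5b). [Cohen GTM 138 §2.4 (HNF), §4.7; folklore] -/
theorem stub_cubicLatticeFP :
    (∀ (a b : ℕ), Squarefree (a * b) → a * b ≠ 1 →
      ∀ (K : Type) [Field K] [NumberField K], Module.finrank ℚ K = 3 →
        ∀ θ : K, θ ^ 3 = ((a * b ^ 2 : ℕ) : K) →
          IsIntegral ℤ θ ∧ IsIntegral ℤ (θ ^ 2 / (b : K)) ∧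
          (∀ ξ : 𝓞 K, ∃ c₀ c₁ c₂ : ℤ, (3 : K) * (ξ : K) = c₀ + c₁ * θ + c₂ * (θ ^ 2 / (b : K))) ∧
          (∀ c₀ c₁ c₂ : ℚ, (c₀ : K) + (c₁ : K) * θ + (c₂ : K) * (θ ^ 2 / (b : K)) = 0 → c₀ = 0 ∧ c₁ = 0 ∧ c₂ = 0) ∧
          (∀ x y z : ℚ, Algebra.norm ℚ ((x : K) + (y : K) * θ + (z : K) * (θ ^ 2 / (b : K))) =
            x ^ 3 + (a * b ^ 2 : ℕ) * y ^ 3 + (a ^ 2 * b : ℕ) * z ^ 3 - 3 * (a * b : ℕ) * x * y * z) ∧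
          (∀ x y z : ℚ, Algebra.trace ℚ K ((x : K) + (y : K) * θ + (z : K) * (θ ^ 2 / (b : K))) = 3 * x)) →
    ∃ (mulE : (ℕ × ℕ) × ((ℤ × ℤ × ℤ × ℕ) × (ℤ × ℤ × ℤ × ℕ)) → ℤ × ℤ × ℤ × ℕ)
      (normE : (ℕ × ℕ) × (ℤ × ℤ × ℤ × ℕ) → ℤ × ℕ)
      (latScale : (ℕ × ℕ) × ((ℕ × List ℤ) × (ℤ × ℤ × ℤ × ℕ)) → ℕ × List ℤ)
      (latProd : (ℕ × ℕ) × ((ℕ × List ℤ) × (ℕ × List ℤ)) → ℕ × List ℤ)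
      (latAddGen : (ℕ × ℕ) × ((ℕ × List ℤ) × (ℤ × ℤ × ℤ × ℕ)) → ℕ × List ℤ),
      CodeFP (pairE (pairE natE natE) (pairE (pairE intE (pairE intE (pairE intE natE))) (pairE intE (pairE intE (pairE intE natE)))))
        (pairE intE (pairE intE (pairE intE natE))) mulE ∧
      CodeFP (pairE (pairE natE natE) (pairE intE (pairE intE (pairE intE natE)))) (pairE intE natE) normE ∧
      CodeFP (pairE (pairE natE natE) (pairE (pairE natE (rawE intE)) (pairE intE (pairE intE (pairE intE natE)))))
        (pairE natE (rawE intE)) latScale ∧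
      CodeFP (pairE (pairE natE natE) (pairE (pairE natE (rawE intE)) (pairE natE (rawE intE)))) (pairE natE (rawE intE)) latProd ∧
      CodeFP (pairE (pairE natE natE) (pairE (pairE natE (rawE intE)) (pairE intE (pairE intE (pairE intE natE)))))
        (pairE natE (rawE intE)) latAddGen ∧
    ∀ (a b : ℕ), Squarefree (a * b) → a * b ≠ 1 →
      ∀ (K : Type) [Field K] [NumberField K], Module.finrank ℚ K = 3 →
        ∀ θ : K, θ ^ 3 = ((a * b ^ 2 : ℕ) : K) →
        (∀ c₀ c₁ c₂ : ℚ, (c₀ : K) + (c₁ : K) * θ + (c₂ : K) * (θ ^ 2 / (b : K)) = 0 → c₀ = 0 ∧ c₁ = 0 ∧ c₂ = 0) →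
        -- multiplication of element codes
        (∀ e₁ e₂ : ℤ × ℤ × ℤ × ℕ, 1 ≤ e₁.2.2.2 → 1 ≤ e₂.2.2.2 →
          1 ≤ (mulE ((a, b), (e₁, e₂))).2.2.2 ∧
          (((((mulE ((a, b), (e₁, e₂))).1 : ℤ) : K) + (((mulE ((a, b), (e₁, e₂))).2.1 : ℤ) : K) * θ + (((mulE ((a, b), (e₁, e₂))).2.2.1 : ℤ) : K) * (θ ^ 2 / (b : K))) /
              (((mulE ((a, b), (e₁, e₂))).2.2.2 : ℕ) : K)) =
            (((((e₁).1 : ℤ) : K) + (((e₁).2.1 : ℤ) : K) * θ + (((e₁).2.2.1 : ℤ) : K) * (θ ^ 2 / (b : K))) /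
              (((e₁).2.2.2 : ℕ) : K)) *
            (((((e₂).1 : ℤ) : K) + (((e₂).2.1 : ℤ) : K) * θ + (((e₂).2.2.1 : ℤ) : K) * (θ ^ 2 / (b : K))) /
              (((e₂).2.2.2 : ℕ) : K))) ∧
        -- the norm of an element code, as numerator/denominator
        (∀ e : ℤ × ℤ × ℤ × ℕ, 1 ≤ e.2.2.2 →
          1 ≤ (normE ((a, b), e)).2 ∧
          (((normE ((a, b), e)).1 : ℤ) : ℚ) / (((normE ((a, b), e)).2 : ℕ) : ℚ) =
            Algebra.norm ℚ (((((e).1 : ℤ) : K) + (((e).2.1 : ℤ) : K) * θ + (((e).2.2.1 : ℤ) : K) * (θ ^ 2 / (b : K))) /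
              (((e).2.2.2 : ℕ) : K))) ∧
        -- canonical codes are unique for a given lattice
        (∀ c c' : ℕ × List ℤ, (∃ (h11 h12 h13 h22 h23 h33 : ℤ), (c).2 = [h11, h12, h13, h22, h23, h33] ∧
            0 < h11 ∧ 0 < h22 ∧ 0 < h33 ∧ 0 ≤ h12 ∧ h12 < h22 ∧ 0 ≤ h13 ∧ h13 < h33 ∧ 0 ≤ h23 ∧ h23 < h33 ∧
            1 ≤ (c).1 ∧ Int.gcd ((c).1 : ℤ) (Int.gcd h11 (Int.gcd h12 (Int.gcd h13 (Int.gcd h22 (Int.gcd h23 h33))))) = 1) → (∃ (h11 h12 h13 h22 h23 h33 : ℤ), (c').2 = [h11, h12, h13, h22, h23, h33] ∧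
            0 < h11 ∧ 0 < h22 ∧ 0 < h33 ∧ 0 ≤ h12 ∧ h12 < h22 ∧ 0 ≤ h13 ∧ h13 < h33 ∧ 0 ≤ h23 ∧ h23 < h33 ∧
            1 ≤ (c').1 ∧ Int.gcd ((c').1 : ℤ) (Int.gcd h11 (Int.gcd h12 (Int.gcd h13 (Int.gcd h22 (Int.gcd h23 h33))))) = 1) →
          (∀ φ : K, (∃ (h11 h12 h13 h22 h23 h33 u v w : ℤ), (c).2 = [h11, h12, h13, h22, h23, h33] ∧
            (((c).1 : ℕ) : K) * (φ) = ((u * h11 : ℤ) : K) + ((u * h12 + v * h22 : ℤ) : K) * θ +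
              ((u * h13 + v * h23 + w * h33 : ℤ) : K) * (θ ^ 2 / (b : K))) ↔ (∃ (h11 h12 h13 h22 h23 h33 u v w : ℤ), (c').2 = [h11, h12, h13, h22, h23, h33] ∧
            (((c').1 : ℕ) : K) * (φ) = ((u * h11 : ℤ) : K) + ((u * h12 + v * h22 : ℤ) : K) * θ +
              ((u * h13 + v * h23 + w * h33 : ℤ) : K) * (θ ^ 2 / (b : K)))) → c = c') ∧
        -- lattice × nonzero element
        (∀ (c : ℕ × List ℤ) (e : ℤ × ℤ × ℤ × ℕ), (∃ (h11 h12 h13 h22 h23 h33 : ℤ), (c).2 = [h11, h12, h13, h22, h23, h33] ∧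
            0 < h11 ∧ 0 < h22 ∧ 0 < h33 ∧ 0 ≤ h12 ∧ h12 < h22 ∧ 0 ≤ h13 ∧ h13 < h33 ∧ 0 ≤ h23 ∧ h23 < h33 ∧
            1 ≤ (c).1 ∧ Int.gcd ((c).1 : ℤ) (Int.gcd h11 (Int.gcd h12 (Int.gcd h13 (Int.gcd h22 (Int.gcd h23 h33))))) = 1) → 1 ≤ e.2.2.2 →
          (((((e).1 : ℤ) : K) + (((e).2.1 : ℤ) : K) * θ + (((e).2.2.1 : ℤ) : K) * (θ ^ 2 / (b : K))) /
              (((e).2.2.2 : ℕ) : K)) ≠ 0 →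
          (∃ (h11 h12 h13 h22 h23 h33 : ℤ), (latScale ((a, b), (c, e))).2 = [h11, h12, h13, h22, h23, h33] ∧
            0 < h11 ∧ 0 < h22 ∧ 0 < h33 ∧ 0 ≤ h12 ∧ h12 < h22 ∧ 0 ≤ h13 ∧ h13 < h33 ∧ 0 ≤ h23 ∧ h23 < h33 ∧
            1 ≤ (latScale ((a, b), (c, e))).1 ∧ Int.gcd ((latScale ((a, b), (c, e))).1 : ℤ) (Int.gcd h11 (Int.gcd h12 (Int.gcd h13 (Int.gcd h22 (Int.gcd h23 h33))))) = 1) ∧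
          ∀ φ : K, (∃ (h11 h12 h13 h22 h23 h33 u v w : ℤ), (latScale ((a, b), (c, e))).2 = [h11, h12, h13, h22, h23, h33] ∧
            (((latScale ((a, b), (c, e))).1 : ℕ) : K) * (φ) = ((u * h11 : ℤ) : K) + ((u * h12 + v * h22 : ℤ) : K) * θ +
              ((u * h13 + v * h23 + w * h33 : ℤ) : K) * (θ ^ 2 / (b : K))) ↔
            ∃ ψ : K, (∃ (h11 h12 h13 h22 h23 h33 u v w : ℤ), (c).2 = [h11, h12, h13, h22, h23, h33] ∧
            (((c).1 : ℕ) : K) * (ψ) = ((u * h11 : ℤ) : K) + ((u * h12 + v * h22 : ℤ) : K) * θ +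
              ((u * h13 + v * h23 + w * h33 : ℤ) : K) * (θ ^ 2 / (b : K))) ∧ φ = ψ * (((((e).1 : ℤ) : K) + (((e).2.1 : ℤ) : K) * θ + (((e).2.2.1 : ℤ) : K) * (θ ^ 2 / (b : K))) /
              (((e).2.2.2 : ℕ) : K))) ∧
        -- lattice × lattice (the ℤ-span of the products)
        (∀ c₁ c₂ : ℕ × List ℤ, (∃ (h11 h12 h13 h22 h23 h33 : ℤ), (c₁).2 = [h11, h12, h13, h22, h23, h33] ∧
            0 < h11 ∧ 0 < h22 ∧ 0 < h33 ∧ 0 ≤ h12 ∧ h12 < h22 ∧ 0 ≤ h13 ∧ h13 < h33 ∧ 0 ≤ h23 ∧ h23 < h33 ∧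
            1 ≤ (c₁).1 ∧ Int.gcd ((c₁).1 : ℤ) (Int.gcd h11 (Int.gcd h12 (Int.gcd h13 (Int.gcd h22 (Int.gcd h23 h33))))) = 1) → (∃ (h11 h12 h13 h22 h23 h33 : ℤ), (c₂).2 = [h11, h12, h13, h22, h23, h33] ∧
            0 < h11 ∧ 0 < h22 ∧ 0 < h33 ∧ 0 ≤ h12 ∧ h12 < h22 ∧ 0 ≤ h13 ∧ h13 < h33 ∧ 0 ≤ h23 ∧ h23 < h33 ∧
            1 ≤ (c₂).1 ∧ Int.gcd ((c₂).1 : ℤ) (Int.gcd h11 (Int.gcd h12 (Int.gcd h13 (Int.gcd h22 (Int.gcd h23 h33))))) = 1) →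
          (∃ (h11 h12 h13 h22 h23 h33 : ℤ), (latProd ((a, b), (c₁, c₂))).2 = [h11, h12, h13, h22, h23, h33] ∧
            0 < h11 ∧ 0 < h22 ∧ 0 < h33 ∧ 0 ≤ h12 ∧ h12 < h22 ∧ 0 ≤ h13 ∧ h13 < h33 ∧ 0 ≤ h23 ∧ h23 < h33 ∧
            1 ≤ (latProd ((a, b), (c₁, c₂))).1 ∧ Int.gcd ((latProd ((a, b), (c₁, c₂))).1 : ℤ) (Int.gcd h11 (Int.gcd h12 (Int.gcd h13 (Int.gcd h22 (Int.gcd h23 h33))))) = 1) ∧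
          ∀ φ : K, (∃ (h11 h12 h13 h22 h23 h33 u v w : ℤ), (latProd ((a, b), (c₁, c₂))).2 = [h11, h12, h13, h22, h23, h33] ∧
            (((latProd ((a, b), (c₁, c₂))).1 : ℕ) : K) * (φ) = ((u * h11 : ℤ) : K) + ((u * h12 + v * h22 : ℤ) : K) * θ +
              ((u * h13 + v * h23 + w * h33 : ℤ) : K) * (θ ^ 2 / (b : K))) ↔
            φ ∈ AddSubgroup.closure {ψ : K | ∃ ψ₁ ψ₂ : K, (∃ (h11 h12 h13 h22 h23 h33 u v w : ℤ), (c₁).2 = [h11, h12, h13, h22, h23, h33] ∧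
            (((c₁).1 : ℕ) : K) * (ψ₁) = ((u * h11 : ℤ) : K) + ((u * h12 + v * h22 : ℤ) : K) * θ +
              ((u * h13 + v * h23 + w * h33 : ℤ) : K) * (θ ^ 2 / (b : K))) ∧ (∃ (h11 h12 h13 h22 h23 h33 u v w : ℤ), (c₂).2 = [h11, h12, h13, h22, h23, h33] ∧
            (((c₂).1 : ℕ) : K) * (ψ₂) = ((u * h11 : ℤ) : K) + ((u * h12 + v * h22 : ℤ) : K) * θ +
              ((u * h13 + v * h23 + w * h33 : ℤ) : K) * (θ ^ 2 / (b : K))) ∧ ψ = ψ₁ * ψ₂}) ∧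
        -- lattice + one generator
        (∀ (c : ℕ × List ℤ) (e : ℤ × ℤ × ℤ × ℕ), (∃ (h11 h12 h13 h22 h23 h33 : ℤ), (c).2 = [h11, h12, h13, h22, h23, h33] ∧
            0 < h11 ∧ 0 < h22 ∧ 0 < h33 ∧ 0 ≤ h12 ∧ h12 < h22 ∧ 0 ≤ h13 ∧ h13 < h33 ∧ 0 ≤ h23 ∧ h23 < h33 ∧
            1 ≤ (c).1 ∧ Int.gcd ((c).1 : ℤ) (Int.gcd h11 (Int.gcd h12 (Int.gcd h13 (Int.gcd h22 (Int.gcd h23 h33))))) = 1) → 1 ≤ e.2.2.2 →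
          (∃ (h11 h12 h13 h22 h23 h33 : ℤ), (latAddGen ((a, b), (c, e))).2 = [h11, h12, h13, h22, h23, h33] ∧
            0 < h11 ∧ 0 < h22 ∧ 0 < h33 ∧ 0 ≤ h12 ∧ h12 < h22 ∧ 0 ≤ h13 ∧ h13 < h33 ∧ 0 ≤ h23 ∧ h23 < h33 ∧
            1 ≤ (latAddGen ((a, b), (c, e))).1 ∧ Int.gcd ((latAddGen ((a, b), (c, e))).1 : ℤ) (Int.gcd h11 (Int.gcd h12 (Int.gcd h13 (Int.gcd h22 (Int.gcd h23 h33))))) = 1) ∧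
          ∀ φ : K, (∃ (h11 h12 h13 h22 h23 h33 u v w : ℤ), (latAddGen ((a, b), (c, e))).2 = [h11, h12, h13, h22, h23, h33] ∧
            (((latAddGen ((a, b), (c, e))).1 : ℕ) : K) * (φ) = ((u * h11 : ℤ) : K) + ((u * h12 + v * h22 : ℤ) : K) * θ +
              ((u * h13 + v * h23 + w * h33 : ℤ) : K) * (θ ^ 2 / (b : K))) ↔
            ∃ (ψ : K) (k : ℤ), (∃ (h11 h12 h13 h22 h23 h33 u v w : ℤ), (c).2 = [h11, h12, h13, h22, h23, h33] ∧
            (((c).1 : ℕ) : K) * (ψ) = ((u * h11 : ℤ) : K) + ((u * h12 + v * h22 : ℤ) : K) * θ +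
              ((u * h13 + v * h23 + w * h33 : ℤ) : K) * (θ ^ 2 / (b : K))) ∧ φ = ψ + (k : K) * (((((e).1 : ℤ) : K) + (((e).2.1 : ℤ) : K) * θ + (((e).2.2.1 : ℤ) : K) * (θ ^ 2 / (b : K))) /
              (((e).2.2.2 : ℕ) : K))) := by
  intro hB
  obtain ⟨⟨h₁, h₂, h₃, h₄, h₅⟩, hspec⟩ := stub_cubicLatticeFPCore
  refine ⟨mulE, normE, latScale, latProd, latAddGen, h₁, h₂, h₃, h₄, h₅, ?_⟩
  intro a b hsq hab1 K _ _ hrank θ hθ hind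
  obtain ⟨-, -, -, -, hnorm, -⟩ := hB a b hsq hab1 K hrank θ hθ
  have hb0 : b ≠ 0 := fun h => by
    rw [h, mul_zero] at hsq
    exact not_squarefree_zero hsq
  have hbK : (b : K) ≠ 0 := by exact_mod_cast hb0
  exact hspec a b K θ hbK hθ hind hnorm

end Summit.QuantumAdvantage.QuantumAdvantage.Theorems.LinnikCubicClassGroups
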